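import Literature.NumberTheory.EllipticCurves.JacobiThetaQuartic
import Literature.NumberTheory.EllipticCurves.UniformizationProofs
import Mathlib.NumberTheory.ModularForms.LevelOne.DimensionFormula
import Mathlib.NumberTheory.ModularForms.Discriminant
import Mathlib.NumberTheory.ModularForms.Identities
import Mathlib.NumberTheory.ModularForms.CuspFormSubmodule
import HarnessLib

/-!
# The theta modular forms `U = θ₀₀⁴`, `V = θ₁₀⁴`, `W = θ₀₁⁴` of weight `2` for `Γ(2)`

Cohn–Kumar–Miller–Radchenko–Viazovska, *Universal optimality of the `E₈` and Leech lattices and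
interpolation formulas*, Ann. of Math. 196 (2022) = arXiv:1902.05438, §2.1 ("Modular forms for
`Γ(2)`"), PROVED from Mathlib and the thetanullwerte of
`Literature/NumberTheory/EllipticCurves/JacobiThetaDerivativeFormula.lean`
(`theta3 = θ₀₀`, `theta4 = θ₀₁`, `theta2 = θ₁₀` on `ℂ`):

* the definitions `U(z) = θ₀₀(z)⁴`, `V(z) = θ₁₀(z)⁴`, `W(z) = θ₀₁(z)⁴` on `ℍ` (`thetaU`, `thetaV`,
  `thetaW`);
* "The modular forms `U`, `V`, and `W` transform under `SL₂(ℤ)` as follows: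
  `U|₂T = W, V|₂T = −V, W|₂T = U, U|₂S = −U, V|₂S = −W, W|₂S = −V`" (`thetaU_slash_T`, …,
  `thetaW_slash_S`, with Mathlib's weight-`k` slash action `∣[k]`);
* "they satisfy the Jacobi identity `U = V + W`" (`thetaU_eq_thetaV_add_thetaW`, from Jacobi's
  quartic identity already in the tree);
* "`E₄ = ½(U² + V² + W²)`, `E₆ = ½(U+V)(U+W)(W−V)`, and `Δ = (UVW)²/256`" (`E₄_eq_theta`,
  `E₆_eq_theta`, `discriminant_eq_theta`, for Mathlib's normalised `E₄`, `E₆` and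
  `Δ = η²⁴`), whence `U, V, W ≠ 0` on `ℍ`;
* §2.1.3: "The modular function `λ = V/U` mapping `ℍ` to `ℂ ∖ {0,1}`" (`modularLambda`,
  `modularLambda_ne_zero`, `modularLambda_ne_one`) with `λ(τ+1) = λ/(λ−1)`, `λ(−1/τ) = 1 − λ`
  (`modularLambda_vadd_one'`, `modularLambda_neg_inv`).

Tools of independent use: `modularFormOfInvariant` (an `S`- and `T`-invariant holomorphic function
bounded at `i∞` is a level-one modular form) and `levelOne_eq_zero_of_tendsto_zero` (weight `< 12`
and limit `0` at `i∞` force `f = 0`). Reused: Jacobi's quartic identity `theta3_pow_four`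
(`…/JacobiThetaQuartic.lean`), `ModularForm.levelOne_tendsto_atImInfty` and
`ModularForm.tendsto_E_atImInfty` (`…/UniformizationProofs.lean`).

## Proofs

The transformation laws are the fourth powers of the laws `θ₃(τ+1) = θ₄`, `θ₄(τ+1) = θ₃`,
`θ₂(τ+1) = e^{πi/4}θ₂`, `θ₃(−1/τ) = (−iτ)^{1/2}θ₃`, `θ₄(−1/τ) = (−iτ)^{1/2}θ₂`,
`θ₂(−1/τ) = (−iτ)^{1/2}θ₄` (Poisson summation, Mathlib). The identities with `E₄`, `E₆`, `Δ`
are obtained by the level-one method that Mathlib's dimension formulas now support: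
`U²+V²+W²` and `(U+V)(U+W)(W−V)` are level-one modular forms of weights `4`, `6` with the limits
`2`, `2` at `i∞`, so their differences with `2E₄`, `2E₆` are cusp forms of weight `< 12`, i.e.
`0`; `(UVW)²` is a cusp form of weight `12`, hence `cΔ` (`S₁₂ = ℂΔ`), and `c = 256` by comparing
`(UVW)²/q → 256` (`e^{−πiτ/4}θ₂ → 2`) with `Δ/q → 1`.

## References

* H. Cohn, A. Kumar, S. D. Miller, D. Radchenko, M. Viazovska, Ann. of Math. 196 (2022) 983–1082,
  arXiv:1902.05438, §2.1 (the displays defining `U, V, W`, the Jacobi identity, the `S, T`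
  transformation table, and `E₄, E₆, Δ` in terms of `U, V, W`). [CohnEtAl2019]
* D. Zagier, *Elliptic modular forms and their applications*, in *The 1-2-3 of Modular Forms*,
  Springer (2008), §3.1 (Jacobi theta series as modular forms of weight `1/2` and `2`).
-/

noncomputable section

open Complex hiding I
open Filter Topology ModularForm SlashInvariantForm
open UpperHalfPlane hiding I
open Complex (I)
open scoped Real MatrixGroups ModularForm Manifold

namespace Literature.NumberTheory.ModularForms

open Literature.NumberTheory.EllipticCurves.JacobiThetaNull

/-! ## Scalar identities -/

/-- The point `−1/τ ∈ ℍ` has coordinate `−1/τ`. [folklore] -/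
theorem coe_mk_neg_inv (τ : ℍ) :
    ((UpperHalfPlane.mk (-(τ : ℂ))⁻¹ τ.im_inv_neg_coe_pos : ℍ) : ℂ) = -1 / (τ : ℂ) := by
  rw [UpperHalfPlane.coe_mk, inv_neg, neg_div, one_div]

/-! ## `U`, `V`, `W` -/

/-- **`U(z) = θ₀₀(z)⁴`**, `θ₀₀(z) = ∑_{n ∈ ℤ} e^{πin²z}` (CKMRV §2.1.2). [cite: CohnEtAl2019, §2.1.2] -/
def thetaU (τ : ℍ) : ℂ := theta3 τ ^ 4

/-- **`V(z) = θ₁₀(z)⁴`**, `θ₁₀(z) = ∑_{n ∈ ℤ} e^{πi(n+1/2)²z}` (CKMRV §2.1.2). [cite: CohnEtAl2019, §2.1.2] -/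
def thetaV (τ : ℍ) : ℂ := theta2 τ ^ 4

/-- **`W(z) = θ₀₁(z)⁴`**, `θ₀₁(z) = ∑_{n ∈ ℤ} (−1)ⁿ e^{πin²z}` (CKMRV §2.1.2). [cite: CohnEtAl2019, §2.1.2] -/
def thetaW (τ : ℍ) : ℂ := theta4 τ ^ 4

/-- `U` unfolds. [folklore] -/
theorem thetaU_apply (τ : ℍ) : thetaU τ = theta3 τ ^ 4 := rfl

/-- `V` unfolds. [folklore] -/
theorem thetaV_apply (τ : ℍ) : thetaV τ = theta2 τ ^ 4 := rfl

/-- `W` unfolds. [folklore] -/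
theorem thetaW_apply (τ : ℍ) : thetaW τ = theta4 τ ^ 4 := rfl

/-! ## Behaviour under `T : τ ↦ τ + 1` and `S : τ ↦ −1/τ` -/

/-- `U(τ + 1) = W(τ)`. [cite: CohnEtAl2019, §2.1.2] -/
theorem thetaU_vadd_one (τ : ℍ) : thetaU ((1 : ℝ) +ᵥ τ) = thetaW τ := by
  rw [thetaU, thetaW, coe_vadd, ofReal_one, add_comm, theta3_add_one]

/-- `W(τ + 1) = U(τ)`. [cite: CohnEtAl2019, §2.1.2] -/
theorem thetaW_vadd_one (τ : ℍ) : thetaW ((1 : ℝ) +ᵥ τ) = thetaU τ := by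
  rw [thetaU, thetaW, coe_vadd, ofReal_one, add_comm, theta4_add_one]

/-- `V(τ + 1) = −V(τ)`. [cite: CohnEtAl2019, §2.1.2] -/
theorem thetaV_vadd_one (τ : ℍ) : thetaV ((1 : ℝ) +ᵥ τ) = -thetaV τ := by
  rw [thetaV, thetaV, coe_vadd, ofReal_one, add_comm, theta2_add_one, mul_pow,
    exp_pi_I_div_four_pow_four]
  ring

/-- `U(−1/τ) = −τ² U(τ)`. [cite: CohnEtAl2019, §2.1.2] -/
theorem thetaU_neg_inv (τ : ℍ) :
    thetaU (UpperHalfPlane.mk (-(τ : ℂ))⁻¹ τ.im_inv_neg_coe_pos) = -(τ : ℂ) ^ 2 * thetaU τ := by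
  rw [thetaU, thetaU, coe_mk_neg_inv, theta3_neg_one_div τ.im_pos, mul_pow, cpow_half_pow_four]

/-- `V(−1/τ) = −τ² W(τ)`. [cite: CohnEtAl2019, §2.1.2] -/
theorem thetaV_neg_inv (τ : ℍ) :
    thetaV (UpperHalfPlane.mk (-(τ : ℂ))⁻¹ τ.im_inv_neg_coe_pos) = -(τ : ℂ) ^ 2 * thetaW τ := by
  rw [thetaV, thetaW, coe_mk_neg_inv, theta2_neg_one_div τ.im_pos, mul_pow, cpow_half_pow_four]

/-- `W(−1/τ) = −τ² V(τ)`. [cite: CohnEtAl2019, §2.1.2] -/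
theorem thetaW_neg_inv (τ : ℍ) :
    thetaW (UpperHalfPlane.mk (-(τ : ℂ))⁻¹ τ.im_inv_neg_coe_pos) = -(τ : ℂ) ^ 2 * thetaV τ := by
  rw [thetaW, thetaV, coe_mk_neg_inv, theta4_neg_one_div τ.im_pos, mul_pow, cpow_half_pow_four]

/-- The weight-`2` action of `T` on a function, pointwise: `(f|₂T)(τ) = f(τ+1)`. [folklore] -/
theorem slash_T_apply (f : ℍ → ℂ) (k : ℤ) (τ : ℍ) :
    (f ∣[k] ModularGroup.T) τ = f ((1 : ℝ) +ᵥ τ) := by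
  rw [SL_slash_apply, modular_T_smul]
  simp [ModularGroup.T, denom]

/-- The weight-`2` action of `S`, pointwise: `(f|₂S)(τ) = τ⁻² f(−1/τ)`. [folklore] -/
theorem slash_two_S_apply (f : ℍ → ℂ) (τ : ℍ) :
    (f ∣[(2 : ℤ)] ModularGroup.S) τ =
      f (UpperHalfPlane.mk (-(τ : ℂ))⁻¹ τ.im_inv_neg_coe_pos) * ((τ : ℂ) ^ 2)⁻¹ := by
  rw [slash_S_apply, zpow_neg, zpow_ofNat]

/-- **`U|₂T = W`.** [cite: CohnEtAl2019, §2.1.2] -/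
theorem thetaU_slash_T : thetaU ∣[(2 : ℤ)] ModularGroup.T = thetaW := by
  ext τ; rw [slash_T_apply, thetaU_vadd_one]

/-- **`V|₂T = −V`.** [cite: CohnEtAl2019, §2.1.2] -/
theorem thetaV_slash_T : thetaV ∣[(2 : ℤ)] ModularGroup.T = -thetaV := by
  ext τ; rw [slash_T_apply, thetaV_vadd_one, Pi.neg_apply]

/-- **`W|₂T = U`.** [cite: CohnEtAl2019, §2.1.2] -/
theorem thetaW_slash_T : thetaW ∣[(2 : ℤ)] ModularGroup.T = thetaU := by
  ext τ; rw [slash_T_apply, thetaW_vadd_one]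

/-- **`U|₂S = −U`.** [cite: CohnEtAl2019, §2.1.2] -/
theorem thetaU_slash_S : thetaU ∣[(2 : ℤ)] ModularGroup.S = -thetaU := by
  ext τ
  rw [slash_two_S_apply, thetaU_neg_inv, Pi.neg_apply, neg_mul, neg_mul, mul_right_comm,
    mul_inv_cancel₀ (pow_ne_zero 2 τ.ne_zero), one_mul]

/-- **`V|₂S = −W`.** [cite: CohnEtAl2019, §2.1.2] -/
theorem thetaV_slash_S : thetaV ∣[(2 : ℤ)] ModularGroup.S = -thetaW := by
  ext τ
  rw [slash_two_S_apply, thetaV_neg_inv, Pi.neg_apply, neg_mul, neg_mul, mul_right_comm,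
    mul_inv_cancel₀ (pow_ne_zero 2 τ.ne_zero), one_mul]

/-- **`W|₂S = −V`.** [cite: CohnEtAl2019, §2.1.2] -/
theorem thetaW_slash_S : thetaW ∣[(2 : ℤ)] ModularGroup.S = -thetaV := by
  ext τ
  rw [slash_two_S_apply, thetaW_neg_inv, Pi.neg_apply, neg_mul, neg_mul, mul_right_comm,
    mul_inv_cancel₀ (pow_ne_zero 2 τ.ne_zero), one_mul]

/-! ## Holomorphy and behaviour at `i∞` -/

/-- A function on `ℍ` that is the restriction of a function on `ℂ` complex-differentiable at every
point of the upper half-plane is `MDifferentiable`. [folklore] -/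
theorem mdifferentiable_of_differentiableAt {g : ℂ → ℂ}
    (hg : ∀ τ : ℂ, 0 < im τ → DifferentiableAt ℂ g τ) : MDiff fun τ : ℍ => g τ := by
  rw [UpperHalfPlane.mdifferentiable_iff]
  have h1 : DifferentiableOn ℂ g {z : ℂ | 0 < z.im} := fun z hz ↦ (hg z hz).differentiableWithinAt
  refine h1.congr fun z hz ↦ ?_
  simp [ofComplex_apply_of_im_pos hz]

/-- `U` is holomorphic on `ℍ`. [folklore] -/
theorem mdifferentiable_thetaU : MDiff thetaU :=
  (mdifferentiable_of_differentiableAt fun _ hτ => differentiableAt_theta3 hτ).pow 4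

/-- `V` is holomorphic on `ℍ`. [folklore] -/
theorem mdifferentiable_thetaV : MDiff thetaV :=
  (mdifferentiable_of_differentiableAt fun _ hτ => differentiableAt_theta2 hτ).pow 4

/-- `W` is holomorphic on `ℍ`. [folklore] -/
theorem mdifferentiable_thetaW : MDiff thetaW :=
  (mdifferentiable_of_differentiableAt fun _ hτ => differentiableAt_theta4 hτ).pow 4

/-- `U(τ) → 1` as `Im τ → ∞`. [folklore] -/
theorem tendsto_thetaU : Tendsto thetaU atImInfty (𝓝 1) := by
  have := (tendsto_theta3.comp tendsto_coe_atImInfty).pow 4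
  rw [one_pow] at this
  exact this

/-- `W(τ) → 1` as `Im τ → ∞`. [folklore] -/
theorem tendsto_thetaW : Tendsto thetaW atImInfty (𝓝 1) := by
  have := (tendsto_theta4.comp tendsto_coe_atImInfty).pow 4
  rw [one_pow] at this
  exact this

/-- `e^{−πiτ} V(τ) → 16` as `Im τ → ∞` (`V = 16 q^{1/2} + ⋯`, `q = e^{2πiτ}`). [folklore] -/
theorem tendsto_exp_mul_thetaV :
    Tendsto (fun τ : ℍ => cexp (-(π * I * τ)) * thetaV τ) atImInfty (𝓝 16) := by
  have := (tendsto_theta2.comp tendsto_coe_atImInfty).pow 4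
  refine (this.congr fun τ => ?_).trans (by norm_num)
  simp only [Function.comp_apply, thetaV, mul_pow, ← Complex.exp_nat_mul]
  congr 2
  push_cast
  ring

/-- `V(τ) → 0` as `Im τ → ∞`. [folklore] -/
theorem tendsto_thetaV : Tendsto thetaV atImInfty (𝓝 0) := by
  have := (tendsto_theta2_zero.comp tendsto_coe_atImInfty).pow 4
  rw [zero_pow (by norm_num)] at this
  exact this

/-! ## Level-one modular forms from `S`- and `T`-invariant functions -/

/-- A holomorphic function on `ℍ` invariant under the weight-`k` actions of `S` and `T` and bounded
at `i∞` is a modular form of weight `k` for `SL₂(ℤ)`. [folklore] -/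
def modularFormOfInvariant (k : ℤ) (g : ℍ → ℂ) (hS : g ∣[k] ModularGroup.S = g)
    (hT : g ∣[k] ModularGroup.T = g) (hhol : MDiff g) (hbdd : IsBoundedAtImInfty g) :
    ModularForm 𝒮ℒ k where
  toFun := g
  slash_action_eq' A hA := by
    obtain ⟨A, rfl⟩ := hA
    exact slash_action_generators_SL2Z hS hT A
  holo' := hhol
  bdd_at_cusps' hc := by
    rw [Subgroup.IsArithmetic.isCusp_iff_isCusp_SL2Z] at hc
    rw [OnePoint.isBoundedAt_iff_forall_SL2Z hc]
    intro γ _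
    rw [slash_action_generators_SL2Z hS hT γ]
    exact hbdd

/-- The modular form built from `g` is `g`, as a function. [folklore] -/
@[simp] theorem coe_modularFormOfInvariant (k : ℤ) (g : ℍ → ℂ)
    (hS : g ∣[k] ModularGroup.S = g) (hT : g ∣[k] ModularGroup.T = g) (hhol : MDiff g)
    (hbdd : IsBoundedAtImInfty g) :
    ⇑(modularFormOfInvariant k g hS hT hhol hbdd) = g := rfl

/-- The modular form built from `g` is `g`. [folklore] -/
@[simp] theorem modularFormOfInvariant_apply (k : ℤ) (g : ℍ → ℂ)
    (hS : g ∣[k] ModularGroup.S = g) (hT : g ∣[k] ModularGroup.T = g) (hhol : MDiff g)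
    (hbdd : IsBoundedAtImInfty g) (τ : ℍ) :
    modularFormOfInvariant k g hS hT hhol hbdd τ = g τ := rfl

/-- **A level-one modular form of weight `< 12` tending to `0` at `i∞` vanishes** (it is a cusp
form, and `S_k(SL₂(ℤ)) = 0` for `k < 12`). [folklore] -/
theorem levelOne_eq_zero_of_tendsto_zero {k : ℤ} (hk : k < 12) (f : ModularForm 𝒮ℒ k)
    (h0 : Tendsto f atImInfty (𝓝 0)) : (f : ℍ → ℂ) = 0 := by
  have hcoeff : (qExpansion 1 f).coeff 0 = 0 :=
    tendsto_nhds_unique (ModularForm.levelOne_tendsto_atImInfty f) h0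
  have hg0 : toCuspForm f hcoeff = 0 :=
    (rank_zero_iff_forall_zero.mp (CuspForm.rank_eq_zero_of_weight_lt_twelve hk)) _
  funext τ
  have := congrArg (fun F : CuspForm 𝒮ℒ k => F τ) hg0
  simpa using this

/-! ## The Jacobi identity `U = V + W` -/

/-- **The Jacobi identity `U = V + W`**, i.e. `θ₀₀⁴ = θ₁₀⁴ + θ₀₁⁴` on `ℍ` — Jacobi's quartic
identity `theta3_pow_four` of `Literature/NumberTheory/EllipticCurves/JacobiThetaQuartic.lean`
(proved there by the level-one method: the square of the defect is a cusp form of weight `4`,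
and `S₄(SL₂(ℤ)) = 0`). [cite: CohnEtAl2019, §2.1.2] -/
theorem thetaU_eq_thetaV_add_thetaW : thetaU = thetaV + thetaW := by
  funext τ
  exact theta3_pow_four (τ : ℂ)

/-- The Jacobi identity, pointwise: `U(τ) = V(τ) + W(τ)`. [cite: CohnEtAl2019, §2.1.2] -/
theorem thetaU_apply_eq (τ : ℍ) : thetaU τ = thetaV τ + thetaW τ :=
  theta3_pow_four (τ : ℂ)

/-! ## `E₄`, `E₆` and `Δ` in terms of `U`, `V`, `W` -/

/-- `U² + V² + W²`. [folklore] -/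
def thetaE4 : ℍ → ℂ := thetaU * thetaU + thetaV * thetaV + thetaW * thetaW

/-- `U² + V² + W²` is invariant of weight `4` under `T`. [folklore] -/
theorem thetaE4_slash_T : thetaE4 ∣[(4 : ℤ)] ModularGroup.T = thetaE4 := by
  rw [thetaE4, show (4 : ℤ) = 2 + 2 by norm_num, SlashAction.add_slash, SlashAction.add_slash,
    mul_slash_SL2, mul_slash_SL2, mul_slash_SL2, thetaU_slash_T, thetaV_slash_T, thetaW_slash_T]
  ring

/-- `U² + V² + W²` is invariant of weight `4` under `S`. [folklore] -/
theorem thetaE4_slash_S : thetaE4 ∣[(4 : ℤ)] ModularGroup.S = thetaE4 := by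
  rw [thetaE4, show (4 : ℤ) = 2 + 2 by norm_num, SlashAction.add_slash, SlashAction.add_slash,
    mul_slash_SL2, mul_slash_SL2, mul_slash_SL2, thetaU_slash_S, thetaV_slash_S, thetaW_slash_S]
  ring

/-- `U² + V² + W²` is holomorphic. [folklore] -/
theorem mdifferentiable_thetaE4 : MDiff thetaE4 :=
  ((mdifferentiable_thetaU.mul mdifferentiable_thetaU).add
    (mdifferentiable_thetaV.mul mdifferentiable_thetaV)).add
    (mdifferentiable_thetaW.mul mdifferentiable_thetaW)

/-- `U² + V² + W² → 2` at `i∞`. [folklore] -/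
theorem tendsto_thetaE4 : Tendsto thetaE4 atImInfty (𝓝 2) := by
  have := ((tendsto_thetaU.mul tendsto_thetaU).add (tendsto_thetaV.mul tendsto_thetaV)).add
    (tendsto_thetaW.mul tendsto_thetaW)
  rw [show (1 : ℂ) * 1 + 0 * 0 + 1 * 1 = 2 by norm_num] at this
  exact this

/-- `U² + V² + W²` as a level-one modular form of weight `4`. [folklore] -/
def thetaE4Form : ModularForm 𝒮ℒ 4 :=
  modularFormOfInvariant 4 thetaE4 thetaE4_slash_S thetaE4_slash_T mdifferentiable_thetaE4
    (tendsto_thetaE4.isBigO_one ℝ)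

/-- **`E₄ = ½(U² + V² + W²)`** (`M₄(SL₂(ℤ)) = ℂE₄` and both sides tend to `1` at `i∞`).
[cite: CohnEtAl2019, §2.1.2] -/
theorem E₄_eq_theta (τ : ℍ) :
    E₄ τ = (thetaU τ ^ 2 + thetaV τ ^ 2 + thetaW τ ^ 2) / 2 := by
  have h0 : Tendsto (⇑(thetaE4Form - (2 : ℂ) • E₄)) atImInfty (𝓝 0) := by
    have := tendsto_thetaE4.sub ((ModularForm.tendsto_E_atImInfty (by norm_num) ⟨2, rfl⟩).const_mul 2)
    rw [show (2 : ℂ) - 2 * 1 = 0 by norm_num] at this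
    refine this.congr fun τ => ?_
    simp [thetaE4Form, smul_eq_mul]
  have h := congrFun (levelOne_eq_zero_of_tendsto_zero (by norm_num) _ h0) τ
  have h' : thetaE4 τ - 2 * E₄ τ = 0 := by
    simpa [ModularForm.sub_apply, thetaE4Form, smul_eq_mul] using h
  simp only [thetaE4, Pi.add_apply, Pi.mul_apply] at h'
  linear_combination (-1 / 2 : ℂ) * h'

/-- `(U + V)(U + W)(W − V)`. [folklore] -/
def thetaE6 : ℍ → ℂ := (thetaU + thetaV) * (thetaU + thetaW) * (thetaW - thetaV)

/-- `(U + V)(U + W)(W − V)` is invariant of weight `6` under `T`. [folklore] -/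
theorem thetaE6_slash_T : thetaE6 ∣[(6 : ℤ)] ModularGroup.T = thetaE6 := by
  rw [thetaE6, show (6 : ℤ) = 2 + 2 + 2 by norm_num, mul_slash_SL2, mul_slash_SL2, sub_eq_add_neg,
    SlashAction.add_slash, SlashAction.add_slash, SlashAction.add_slash, SlashAction.neg_slash,
    thetaU_slash_T, thetaV_slash_T, thetaW_slash_T]
  ring

/-- `(U + V)(U + W)(W − V)` is invariant of weight `6` under `S`. [folklore] -/
theorem thetaE6_slash_S : thetaE6 ∣[(6 : ℤ)] ModularGroup.S = thetaE6 := by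
  rw [thetaE6, show (6 : ℤ) = 2 + 2 + 2 by norm_num, mul_slash_SL2, mul_slash_SL2, sub_eq_add_neg,
    SlashAction.add_slash, SlashAction.add_slash, SlashAction.add_slash, SlashAction.neg_slash,
    thetaU_slash_S, thetaV_slash_S, thetaW_slash_S]
  ring

/-- `(U + V)(U + W)(W − V)` is holomorphic. [folklore] -/
theorem mdifferentiable_thetaE6 : MDiff thetaE6 :=
  ((mdifferentiable_thetaU.add mdifferentiable_thetaV).mul
    (mdifferentiable_thetaU.add mdifferentiable_thetaW)).mul
    (mdifferentiable_thetaW.sub mdifferentiable_thetaV)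

/-- `(U + V)(U + W)(W − V) → 2` at `i∞`. [folklore] -/
theorem tendsto_thetaE6 : Tendsto thetaE6 atImInfty (𝓝 2) := by
  have := ((tendsto_thetaU.add tendsto_thetaV).mul (tendsto_thetaU.add tendsto_thetaW)).mul
    (tendsto_thetaW.sub tendsto_thetaV)
  rw [show ((1 : ℂ) + 0) * (1 + 1) * (1 - 0) = 2 by norm_num] at this
  exact this

/-- `(U + V)(U + W)(W − V)` as a level-one modular form of weight `6`. [folklore] -/
def thetaE6Form : ModularForm 𝒮ℒ 6 :=
  modularFormOfInvariant 6 thetaE6 thetaE6_slash_S thetaE6_slash_T mdifferentiable_thetaE6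
    (tendsto_thetaE6.isBigO_one ℝ)

/-- **`E₆ = ½(U + V)(U + W)(W − V)`** (`M₆(SL₂(ℤ)) = ℂE₆` and both sides tend to `1` at `i∞`).
[cite: CohnEtAl2019, §2.1.2] -/
theorem E₆_eq_theta (τ : ℍ) :
    E₆ τ = (thetaU τ + thetaV τ) * (thetaU τ + thetaW τ) * (thetaW τ - thetaV τ) / 2 := by
  have h0 : Tendsto (⇑(thetaE6Form - (2 : ℂ) • E₆)) atImInfty (𝓝 0) := by
    have := tendsto_thetaE6.sub ((ModularForm.tendsto_E_atImInfty (by norm_num) ⟨3, rfl⟩).const_mul 2)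
    rw [show (2 : ℂ) - 2 * 1 = 0 by norm_num] at this
    refine this.congr fun τ => ?_
    simp [thetaE6Form, smul_eq_mul]
  have h := congrFun (levelOne_eq_zero_of_tendsto_zero (by norm_num) _ h0) τ
  have h' : thetaE6 τ - 2 * E₆ τ = 0 := by
    simpa [ModularForm.sub_apply, thetaE6Form, smul_eq_mul] using h
  simp only [thetaE6, Pi.add_apply, Pi.mul_apply, Pi.sub_apply] at h'
  linear_combination (-1 / 2 : ℂ) * h'

/-- `UVW`. [folklore] -/
def thetaUVW : ℍ → ℂ := thetaU * thetaV * thetaW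

/-- `(UVW)|₆T = −UVW`. [folklore] -/
theorem thetaUVW_slash_T : thetaUVW ∣[(6 : ℤ)] ModularGroup.T = -thetaUVW := by
  rw [thetaUVW, show (6 : ℤ) = 2 + 2 + 2 by norm_num, mul_slash_SL2, mul_slash_SL2, thetaU_slash_T,
    thetaV_slash_T, thetaW_slash_T]
  ring

/-- `(UVW)|₆S = −UVW`. [folklore] -/
theorem thetaUVW_slash_S : thetaUVW ∣[(6 : ℤ)] ModularGroup.S = -thetaUVW := by
  rw [thetaUVW, show (6 : ℤ) = 2 + 2 + 2 by norm_num, mul_slash_SL2, mul_slash_SL2, thetaU_slash_S,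
    thetaV_slash_S, thetaW_slash_S]
  ring

/-- `(UVW)²` is invariant of weight `12` under any `γ` with `(UVW)|₆γ = −UVW`. [folklore] -/
theorem thetaUVW_sq_slash {γ : SL(2, ℤ)} (h : thetaUVW ∣[(6 : ℤ)] γ = -thetaUVW) :
    (thetaUVW * thetaUVW) ∣[(12 : ℤ)] γ = thetaUVW * thetaUVW := by
  rw [show (12 : ℤ) = 6 + 6 by norm_num, mul_slash_SL2, h, neg_mul_neg]

/-- `UVW` is holomorphic. [folklore] -/
theorem mdifferentiable_thetaUVW : MDiff thetaUVW :=
  (mdifferentiable_thetaU.mul mdifferentiable_thetaV).mul mdifferentiable_thetaW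

/-- `UVW → 0` at `i∞`. [folklore] -/
theorem tendsto_thetaUVW : Tendsto thetaUVW atImInfty (𝓝 0) := by
  have := (tendsto_thetaU.mul tendsto_thetaV).mul tendsto_thetaW
  rw [show (1 : ℂ) * 0 * 1 = 0 by norm_num] at this
  exact this

/-- `e^{−2πiτ} (UVW)²(τ) → 256` at `i∞`. [folklore] -/
theorem tendsto_exp_mul_thetaUVW_sq :
    Tendsto (fun τ : ℍ => cexp (-(2 * π * I * τ)) * (thetaUVW τ * thetaUVW τ)) atImInfty
      (𝓝 256) := by
  have := ((tendsto_thetaU.mul tendsto_exp_mul_thetaV).mul tendsto_thetaW).mul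
    ((tendsto_thetaU.mul tendsto_exp_mul_thetaV).mul tendsto_thetaW)
  rw [show ((1 : ℂ) * 16 * 1) * (1 * 16 * 1) = 256 by norm_num] at this
  refine this.congr fun τ => ?_
  simp only [thetaUVW, Pi.mul_apply]
  rw [show -(2 * π * I * (τ : ℂ)) = -(π * I * τ) + -(π * I * τ) by ring, Complex.exp_add]
  ring

/-- `(UVW)²` as a level-one modular form of weight `12`. [folklore] -/
def thetaUVWSqForm : ModularForm 𝒮ℒ 12 :=
  modularFormOfInvariant 12 (thetaUVW * thetaUVW) (thetaUVW_sq_slash thetaUVW_slash_S)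
    (thetaUVW_sq_slash thetaUVW_slash_T) (mdifferentiable_thetaUVW.mul mdifferentiable_thetaUVW)
    ((tendsto_thetaUVW.mul tendsto_thetaUVW).isBigO_one ℝ)

/-- `(UVW)²` has vanishing constant term. [folklore] -/
theorem thetaUVWSqForm_coeff_zero : (qExpansion 1 thetaUVWSqForm).coeff 0 = 0 := by
  have h0 : Tendsto thetaUVWSqForm atImInfty (𝓝 0) := by
    rw [show ⇑thetaUVWSqForm = thetaUVW * thetaUVW from rfl]
    have := tendsto_thetaUVW.mul tendsto_thetaUVW
    rw [mul_zero] at this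
    exact this
  exact tendsto_nhds_unique (ModularForm.levelOne_tendsto_atImInfty _) h0

/-- `Δ(τ) e^{−2πiτ} → 1` at `i∞` (`Δ = q ∏(1 − qⁿ)²⁴`). [folklore] -/
theorem tendsto_exp_mul_discriminant :
    Tendsto (fun τ : ℍ => cexp (-(2 * π * I * τ)) * ModularForm.discriminant τ) atImInfty
      (𝓝 1) := by
  refine ModularForm.tendsto_atImInfty_tprod_one_sub_eta_q_pow.congr fun τ => ?_
  rw [ModularForm.discriminant_eq_q_prod, ← mul_assoc, Function.Periodic.qParam, ← Complex.exp_add,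
    show -(2 * π * I * (τ : ℂ)) + 2 * π * I * τ / (1 : ℝ) = 0 by push_cast; ring, Complex.exp_zero,
    one_mul]

/-- **`Δ = (UVW)²/256`** (`(UVW)²` is a cusp form of weight `12` for `SL₂(ℤ)`, hence `cΔ` since
`S₁₂ = ℂΔ`; `c = 256` by comparing `(UVW)² ∼ 256q` with `Δ ∼ q`). [cite: CohnEtAl2019, §2.1.2] -/
theorem discriminant_eq_theta (τ : ℍ) :
    ModularForm.discriminant τ = (thetaU τ * thetaV τ * thetaW τ) ^ 2 / 256 := by
  obtain ⟨c, hc⟩ :=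
    CuspForm.exists_smul_discriminant_of_weight_eq_twelve (toCuspForm _ thetaUVWSqForm_coeff_zero)
  have hpt : ∀ σ : ℍ, thetaUVW σ * thetaUVW σ = c * ModularForm.discriminant σ := fun σ => by
    have := congrArg (fun F : CuspForm 𝒮ℒ 12 => F σ) hc
    simpa [toCuspForm_apply, thetaUVWSqForm] using this.symm
  -- identify the constant
  have hlim : Tendsto (fun τ : ℍ => cexp (-(2 * π * I * τ)) * (thetaUVW τ * thetaUVW τ))
      atImInfty (𝓝 (c * 1)) := by
    refine (tendsto_exp_mul_discriminant.const_mul c).congr fun τ => ?_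
    rw [hpt τ]; ring
  have hc256 : c = 256 := by
    have := tendsto_nhds_unique hlim tendsto_exp_mul_thetaUVW_sq
    rwa [mul_one] at this
  have h := hpt τ
  rw [hc256] at h
  simp only [thetaUVW, Pi.mul_apply] at h
  linear_combination (-1 / 256 : ℂ) * h

/-! ## Non-vanishing; the modular function `λ = V/U` -/

/-- `U(τ) ≠ 0` on `ℍ` (`Δ = (UVW)²/256 ≠ 0`). [folklore] -/
theorem thetaU_ne_zero (τ : ℍ) : thetaU τ ≠ 0 := fun h => by
  have := discriminant_eq_theta τ
  rw [h, zero_mul, zero_mul, zero_pow two_ne_zero, zero_div] at this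
  exact ModularForm.discriminant_ne_zero τ this

/-- `V(τ) ≠ 0` on `ℍ`. [folklore] -/
theorem thetaV_ne_zero (τ : ℍ) : thetaV τ ≠ 0 := fun h => by
  have := discriminant_eq_theta τ
  rw [h, mul_zero, zero_mul, zero_pow two_ne_zero, zero_div] at this
  exact ModularForm.discriminant_ne_zero τ this

/-- `W(τ) ≠ 0` on `ℍ`. [folklore] -/
theorem thetaW_ne_zero (τ : ℍ) : thetaW τ ≠ 0 := fun h => by
  have := discriminant_eq_theta τ
  rw [h, mul_zero, zero_pow two_ne_zero, zero_div] at this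
  exact ModularForm.discriminant_ne_zero τ this

/-- **The modular `λ`-function** `λ = V/U = θ₁₀⁴/θ₀₀⁴ : ℍ → ℂ ∖ {0, 1}`, the Hauptmodul of `Γ(2)`
(CKMRV §2.1.3). [cite: CohnEtAl2019, §2.1.3] -/
def modularLambda (τ : ℍ) : ℂ := thetaV τ / thetaU τ

/-- `λ(τ) ≠ 0` (`λ : ℍ → ℂ ∖ {0, 1}`). [cite: CohnEtAl2019, §2.1.3] -/
theorem modularLambda_ne_zero (τ : ℍ) : modularLambda τ ≠ 0 :=
  div_ne_zero (thetaV_ne_zero τ) (thetaU_ne_zero τ)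

/-- `1 − λ = W/U` (Jacobi identity). [cite: CohnEtAl2019, §2.1.3] -/
theorem one_sub_modularLambda (τ : ℍ) : 1 - modularLambda τ = thetaW τ / thetaU τ := by
  rw [modularLambda, eq_div_iff (thetaU_ne_zero τ), sub_mul, div_mul_cancel₀ _ (thetaU_ne_zero τ),
    one_mul, thetaU_apply_eq, add_sub_cancel_left]

/-- `λ(τ) ≠ 1` (`λ : ℍ → ℂ ∖ {0, 1}`). [cite: CohnEtAl2019, §2.1.3] -/
theorem modularLambda_ne_one (τ : ℍ) : modularLambda τ ≠ 1 := fun h => by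
  have := one_sub_modularLambda τ
  rw [h, sub_self, eq_comm, div_eq_zero_iff] at this
  exact this.elim (thetaW_ne_zero τ) (thetaU_ne_zero τ)

/-- `λ(τ + 1) = −V(τ)/W(τ)`. [cite: CohnEtAl2019, §2.1.3] -/
theorem modularLambda_vadd_one (τ : ℍ) : modularLambda ((1 : ℝ) +ᵥ τ) = -(thetaV τ / thetaW τ) := by
  rw [modularLambda, thetaV_vadd_one, thetaU_vadd_one, neg_div]

/-- `λ(τ + 1) = λ(τ)/(λ(τ) − 1)`. [cite: CohnEtAl2019, §2.1.3] -/
theorem modularLambda_vadd_one' (τ : ℍ) :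
    modularLambda ((1 : ℝ) +ᵥ τ) = modularLambda τ / (modularLambda τ - 1) := by
  have hU := thetaU_ne_zero τ
  have hW := thetaW_ne_zero τ
  have h1 : modularLambda τ - 1 = -(thetaW τ / thetaU τ) := by
    rw [← one_sub_modularLambda]; ring
  rw [modularLambda_vadd_one, h1, modularLambda]
  field_simp

/-- `λ(−1/τ) = W(τ)/U(τ) = 1 − λ(τ)`. [cite: CohnEtAl2019, §2.1.3] -/
theorem modularLambda_neg_inv (τ : ℍ) :
    modularLambda (UpperHalfPlane.mk (-(τ : ℂ))⁻¹ τ.im_inv_neg_coe_pos) = 1 - modularLambda τ := by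
  have hτ : -(τ : ℂ) ^ 2 ≠ 0 := neg_ne_zero.mpr (pow_ne_zero 2 τ.ne_zero)
  rw [modularLambda, thetaV_neg_inv, thetaU_neg_inv, one_sub_modularLambda,
    mul_div_mul_left _ _ hτ]

end Literature.NumberTheory.ModularForms
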